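import Summits.Ventures.PercRepro.S1SpreadSlackZeroBase

/-!
# PercRepro — THE SLACK-ZERO STRUCTURE THEOREM, PART A: THE NULLITY CHAINS AND THE CASE `s = 2` (p1, gen 36)

`proofs/P1-S2-CORANK6.md` §4u. `C` is a `4`-circuit and `T₁, …, T_s` are triangles whose private points lie in `C`; the
budget `|C ∪ T₁ ∪ … ∪ T_s| ≤ rk (…) + s` (the main module derives it from `t = d`, `ncard_union_filter_le_eRk_add_card`)
and the nullity steps (`nullity_step`) say that, in any order, at most `s − 1` of the triangles bring a new point:
**`chain_two` / `chain_three` / `chain_four`**. The case `s = 2` (**`eq_sdiff_inter_of_two`**): `T₂ ⊆ C ∪ T₁` and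
`T₁ ⊆ C ∪ T₂`, so `T₁ ∖ C = T₂ ∖ C` is the single common point `c` of the two triangles and `C = (T₁ ∪ T₂) ∖ {c}`.
Tools for the cases `s = 3, 4` (the sequels): the one-point containment structure (`structure_of_subset_union`), two points
of a triangle outside `C` cannot both lie on another triangle (`not_subset_union_of_two_outside`), a triangle meeting `C` only
in `p` has two further points (`exists_two_outside`, `ncard_sdiff_eq_two_of_inter`). Nothing about any cell is claimed.
Axioms: standard.
-/

open scoped Matroid

namespace PercRepro

namespace S1

open Set

variable {α : Type}

/-- A `4`-circuit has rank `3` (as a natural number). -/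
theorem eRk_toNat_eq_three_of_four (M : Matroid α) [M.Finite] {C : Set α} (hC : M.IsCircuit C) (hC4 : C.ncard = 4) :
    (M.eRk C).toNat = 3 := by
  have hCfin : C.Finite := M.ground_finite.subset hC.subset_ground
  have h := hC.eRk_add_one_eq
  rw [← coe_toNat_eRk M hC.subset_ground, ← hCfin.cast_ncard_eq, hC4] at h
  have h' : (M.eRk C).toNat + 1 = 4 := by exact_mod_cast h
  omega

/-- A triangle is not inside a `4`-circuit. -/
theorem tri_not_subset_four (M : Matroid α) {C T : Set α} (hC : M.IsCircuit C) (hC4 : C.ncard = 4)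
    (hT : M.IsCircuit T) (hT3 : T.ncard = 3) : ¬ T ⊆ C := by
  intro h
  have := hT.eq_of_subset_isCircuit hC h
  subst this
  omega

/-- **Two steps under budget `2`**: `T₂ ⊆ C ∪ T₁`. -/
theorem chain_two (M : Matroid α) [M.Finite] {C T₁ T₂ : Set α} (hC : M.IsCircuit C) (hC4 : C.ncard = 4)
    (hT₁ : M.IsCircuit T₁) (hT₁C : ¬ T₁ ⊆ C) (hT₂ : M.IsCircuit T₂)
    (hbud : (C ∪ T₁ ∪ T₂).ncard ≤ (M.eRk (C ∪ T₁ ∪ T₂)).toNat + 2) : T₂ ⊆ C ∪ T₁ := by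
  by_contra hnot
  have h1 := nullity_step M hC.subset_ground hT₁ hT₁C
  have h2 := nullity_step M (union_subset hC.subset_ground hT₁.subset_ground) hT₂ hnot
  rw [eRk_toNat_eq_three_of_four M hC hC4, hC4] at h1
  omega

/-- **Three steps under budget `3`**: `T₂ ⊆ C ∪ T₁` or `T₃ ⊆ C ∪ T₁ ∪ T₂`. -/
theorem chain_three (M : Matroid α) [M.Finite] {C T₁ T₂ T₃ : Set α} (hC : M.IsCircuit C) (hC4 : C.ncard = 4)
    (hT₁ : M.IsCircuit T₁) (hT₁C : ¬ T₁ ⊆ C) (hT₂ : M.IsCircuit T₂) (hT₃ : M.IsCircuit T₃)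
    (hbud : (C ∪ T₁ ∪ T₂ ∪ T₃).ncard ≤ (M.eRk (C ∪ T₁ ∪ T₂ ∪ T₃)).toNat + 3) :
    T₂ ⊆ C ∪ T₁ ∨ T₃ ⊆ C ∪ T₁ ∪ T₂ := by
  by_contra hnot
  push Not at hnot
  have h1 := nullity_step M hC.subset_ground hT₁ hT₁C
  have h2 := nullity_step M (union_subset hC.subset_ground hT₁.subset_ground) hT₂ hnot.1
  have h3 := nullity_step M (union_subset (union_subset hC.subset_ground hT₁.subset_ground) hT₂.subset_ground) hT₃ hnot.2
  rw [eRk_toNat_eq_three_of_four M hC hC4, hC4] at h1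
  omega

/-- **Four steps under budget `4`** with `T₂ ⊄ C ∪ T₁`: `T₃ ⊆ C ∪ T₁ ∪ T₂` or `T₄ ⊆ C ∪ T₁ ∪ T₂ ∪ T₃`. -/
theorem chain_four (M : Matroid α) [M.Finite] {C T₁ T₂ T₃ T₄ : Set α} (hC : M.IsCircuit C) (hC4 : C.ncard = 4)
    (hT₁ : M.IsCircuit T₁) (hT₁C : ¬ T₁ ⊆ C) (hT₂ : M.IsCircuit T₂) (hT₂C : ¬ T₂ ⊆ C ∪ T₁)
    (hT₃ : M.IsCircuit T₃) (hT₄ : M.IsCircuit T₄)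
    (hbud : (C ∪ T₁ ∪ T₂ ∪ T₃ ∪ T₄).ncard ≤ (M.eRk (C ∪ T₁ ∪ T₂ ∪ T₃ ∪ T₄)).toNat + 4) :
    T₃ ⊆ C ∪ T₁ ∪ T₂ ∨ T₄ ⊆ C ∪ T₁ ∪ T₂ ∪ T₃ := by
  by_contra hnot
  push Not at hnot
  have hU₁ : C ∪ T₁ ⊆ M.E := union_subset hC.subset_ground hT₁.subset_ground
  have hU₂ : C ∪ T₁ ∪ T₂ ⊆ M.E := union_subset hU₁ hT₂.subset_ground
  have hU₃ : C ∪ T₁ ∪ T₂ ∪ T₃ ⊆ M.E := union_subset hU₂ hT₃.subset_ground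
  have h1 := nullity_step M hC.subset_ground hT₁ hT₁C
  have h2 := nullity_step M hU₁ hT₂ hT₂C
  have h3 := nullity_step M hU₂ hT₃ hnot.1
  have h4 := nullity_step M hU₃ hT₄ hnot.2
  rw [eRk_toNat_eq_three_of_four M hC hC4, hC4] at h1
  omega

/-- **`s = 2`: the circuit is the symmetric difference of the two triangles, which share exactly one point.** -/
theorem eq_sdiff_inter_of_two (M : Matroid α) [M.Finite]
    (hC1 : ∀ L ⊆ M.E, M.eRk L = 2 → L.ncard ≤ 3)
    {C T₁ T₂ : Set α} (hC : M.IsCircuit C) (hC4 : C.ncard = 4)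
    (hT₁ : M.IsCircuit T₁) (hT₁3 : T₁.ncard = 3) (hT₂ : M.IsCircuit T₂) (hT₂3 : T₂.ncard = 3) (h12 : T₁ ≠ T₂)
    (hbud : (C ∪ T₁ ∪ T₂).ncard ≤ (M.eRk (C ∪ T₁ ∪ T₂)).toNat + 2) :
    C = (T₁ ∪ T₂) \ (T₁ ∩ T₂) ∧ (T₁ ∩ T₂).ncard = 1 := by
  have hCfin : C.Finite := M.ground_finite.subset hC.subset_ground
  have hT₁fin : T₁.Finite := M.ground_finite.subset hT₁.subset_ground
  have hT₂fin : T₂.Finite := M.ground_finite.subset hT₂.subset_ground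
  have hT₁C : ¬ T₁ ⊆ C := tri_not_subset_four M hC hC4 hT₁ hT₁3
  have hT₂C : ¬ T₂ ⊆ C := tri_not_subset_four M hC hC4 hT₂ hT₂3
  have h21 : T₂ ⊆ C ∪ T₁ := chain_two M hC hC4 hT₁ hT₁C hT₂ hbud
  have h12' : T₁ ⊆ C ∪ T₂ := by
    have hbud' : (C ∪ T₂ ∪ T₁).ncard ≤ (M.eRk (C ∪ T₂ ∪ T₁)).toNat + 2 := by
      have : C ∪ T₂ ∪ T₁ = C ∪ T₁ ∪ T₂ := by ac_rfl
      rw [this]; exact hbud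
    exact chain_two M hC hC4 hT₂ hT₂C hT₁ hbud'
  have hinter : (T₁ ∩ T₂).ncard ≤ 1 := S2.ncard_inter_le_one_of_triangles M hC1 hT₁ hT₁3 hT₂ hT₂3 h12
  -- `T₁ ∖ C = T₂ ∖ C ⊆ T₁ ∩ T₂`
  have hsub₁ : T₁ \ C ⊆ T₁ ∩ T₂ := by
    intro x hx
    refine ⟨hx.1, ?_⟩
    rcases h12' hx.1 with h | h
    · exact absurd h hx.2
    · exact h
  have hsub₂ : T₂ \ C ⊆ T₁ ∩ T₂ := by
    intro x hx
    refine ⟨?_, hx.1⟩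
    rcases h21 hx.1 with h | h
    · exact absurd h hx.2
    · exact h
  obtain ⟨c, hcT₁, hcC⟩ : ∃ c ∈ T₁, c ∉ C := by
    by_contra h; push Not at h; exact hT₁C h
  have hcI : c ∈ T₁ ∩ T₂ := hsub₁ ⟨hcT₁, hcC⟩
  have hI : T₁ ∩ T₂ = {c} :=
    (Set.eq_of_subset_of_ncard_le (by simpa using hcI : ({c} : Set α) ⊆ T₁ ∩ T₂)
      (by rw [Set.ncard_singleton]; exact hinter) (hT₁fin.subset inter_subset_left)).symm
  have hI1 : (T₁ ∩ T₂).ncard = 1 := by rw [hI]; exact Set.ncard_singleton c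
  refine ⟨?_, hI1⟩
  -- `(T₁ ∪ T₂) ∖ (T₁ ∩ T₂) ⊆ C`, both of size `4`
  have hsubC : (T₁ ∪ T₂) \ (T₁ ∩ T₂) ⊆ C := by
    intro x hx
    by_contra hxC
    rcases hx.1 with h | h
    · exact hx.2 (hsub₁ ⟨h, hxC⟩)
    · exact hx.2 (hsub₂ ⟨h, hxC⟩)
  have hcard : ((T₁ ∪ T₂) \ (T₁ ∩ T₂)).ncard = 4 := by
    have hu := Set.ncard_union_add_ncard_inter T₁ T₂ hT₁fin hT₂fin
    rw [Set.ncard_sdiff' (inter_subset_left.trans subset_union_left) (hT₁fin.union hT₂fin), hI1]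
    omega
  symm
  exact Set.eq_of_subset_of_ncard_le hsubC (by rw [hcard, hC4]) hCfin

/-- **The one-point case of a containment**: `T ⊆ C ∪ T'` for a triangle `T` whose trace on the `4`-circuit `C` is inside
`{p, u}` (`p, u ∈ C`) forces `T = {p, u, c}` with `c ∈ T' ∖ C` and `u ∉ T'`. -/
theorem structure_of_subset_union (M : Matroid α) [M.Finite]
    (hC1 : ∀ L ⊆ M.E, M.eRk L = 2 → L.ncard ≤ 3)
    {C T T' : Set α} (hC : M.IsCircuit C) (hC4 : C.ncard = 4)
    (hT : M.IsCircuit T) (hT3 : T.ncard = 3) (hT' : M.IsCircuit T') (hT'3 : T'.ncard = 3) (hne : T ≠ T')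
    {p u : α} (hpC : p ∈ C) (huC : u ∈ C) (hpu : p ≠ u) (hTC : T ∩ C ⊆ {p, u})
    (hsub : T ⊆ C ∪ T') :
    ∃ c, T = {p, u, c} ∧ c ∈ T' ∧ c ∉ C ∧ u ∉ T' ∧ u ∈ T := by
  have hTfin : T.Finite := M.ground_finite.subset hT.subset_ground
  have hTC' : ¬ T ⊆ C := tri_not_subset_four M hC hC4 hT hT3
  obtain ⟨c, hcT, hcC⟩ : ∃ c ∈ T, c ∉ C := by
    by_contra h; push Not at h; exact hTC' h
  have hcT' : c ∈ T' := by
    rcases hsub hcT with h | h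
    · exact absurd h hcC
    · exact h
  have hinter : (T ∩ T').ncard ≤ 1 := S2.ncard_inter_le_one_of_triangles M hC1 hT hT3 hT' hT'3 hne
  -- every other point of `T` outside `C` would be a second point of `T ∩ T'`
  have honly : ∀ x ∈ T, x ∉ C → x = c := by
    intro x hxT hxC
    by_contra hxc
    have hxT' : x ∈ T' := by
      rcases hsub hxT with h | h
      · exact absurd h hxC
      · exact h
    have : 2 ≤ (T ∩ T').ncard := by
      have hp : ({x, c} : Set α) ⊆ T ∩ T' := by
        intro v hv; rcases hv with rfl | rfl; exact ⟨hxT, hxT'⟩; exact ⟨hcT, hcT'⟩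
      have := Set.ncard_le_ncard hp (hTfin.subset inter_subset_left)
      rwa [Set.ncard_pair hxc] at this
    omega
  have hpc : p ≠ c := fun h => hcC (h ▸ hpC)
  have huc : u ≠ c := fun h => hcC (h ▸ huC)
  have hTsub : T ⊆ {p, u, c} := by
    intro x hxT
    by_cases hxC : x ∈ C
    · rcases hTC ⟨hxT, hxC⟩ with h | h
      · exact Or.inl h
      · exact Or.inr (Or.inl h)
    · exact Or.inr (Or.inr (mem_singleton_iff.2 (honly x hxT hxC)))
  have hTeq : T = {p, u, c} := by
    apply Set.eq_of_subset_of_ncard_le hTsub _ (toFinite _)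
    rw [hT3, Set.ncard_insert_of_notMem (by simp only [mem_insert_iff, mem_singleton_iff, not_or]; exact ⟨hpu, hpc⟩)
      (toFinite _), Set.ncard_pair huc]
  have huT : u ∈ T := by rw [hTeq]; exact Or.inr (Or.inl rfl)
  have huT' : u ∉ T' := by
    intro huT'
    have : 2 ≤ (T ∩ T').ncard := by
      have hp : ({u, c} : Set α) ⊆ T ∩ T' := by
        intro v hv; rcases hv with rfl | rfl; exact ⟨huT, huT'⟩; exact ⟨hcT, hcT'⟩
      have := Set.ncard_le_ncard hp (hTfin.subset inter_subset_left)
      rwa [Set.ncard_pair huc] at this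
    omega
  exact ⟨c, hTeq, hcT', hcC, huT', huT⟩

/-- Two points of a triangle `T` outside `C` cannot both lie on another triangle `T'`: `T ⊄ C ∪ T'`. -/
theorem not_subset_union_of_two_outside (M : Matroid α) [M.Finite]
    (hC1 : ∀ L ⊆ M.E, M.eRk L = 2 → L.ncard ≤ 3)
    {C T T' : Set α} (hT : M.IsCircuit T) (hT3 : T.ncard = 3) (hT' : M.IsCircuit T') (hT'3 : T'.ncard = 3)
    (hne : T ≠ T') {x y : α} (hxT : x ∈ T) (hxC : x ∉ C) (hyT : y ∈ T) (hyC : y ∉ C) (hxy : x ≠ y) :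
    ¬ T ⊆ C ∪ T' := by
  intro hsub
  have hTfin : T.Finite := M.ground_finite.subset hT.subset_ground
  have hinter : (T ∩ T').ncard ≤ 1 := S2.ncard_inter_le_one_of_triangles M hC1 hT hT3 hT' hT'3 hne
  have hxT' : x ∈ T' := by rcases hsub hxT with h | h; exact absurd h hxC; exact h
  have hyT' : y ∈ T' := by rcases hsub hyT with h | h; exact absurd h hyC; exact h
  have : 2 ≤ (T ∩ T').ncard := by
    have hp : ({x, y} : Set α) ⊆ T ∩ T' := by
      intro v hv; rcases hv with rfl | rfl; exact ⟨hxT, hxT'⟩; exact ⟨hyT, hyT'⟩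
    have := Set.ncard_le_ncard hp (hTfin.subset inter_subset_left)
    rwa [Set.ncard_pair hxy] at this
  omega

/-- A triangle meeting the `4`-circuit `C` in exactly one point `p` has two further points `x ≠ y` outside `C`. -/
theorem exists_two_outside (M : Matroid α) [M.Finite] {C T : Set α} (hT : M.IsCircuit T) (hT3 : T.ncard = 3)
    {p : α} (hTC : T ∩ C ⊆ {p}) : ∃ x y, x ≠ y ∧ x ∈ T ∧ x ∉ C ∧ y ∈ T ∧ y ∉ C := by
  have hTfin : T.Finite := M.ground_finite.subset hT.subset_ground
  have h := Set.ncard_inter_add_ncard_sdiff_eq_ncard T C hTfin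
  have h1 : (T ∩ C).ncard ≤ 1 := by
    have := Set.ncard_le_ncard hTC (toFinite _)
    rwa [Set.ncard_singleton] at this
  have h2 : 1 < (T \ C).ncard := by omega
  obtain ⟨x, y, hx, hy, hxy⟩ := (Set.one_lt_ncard_iff (hTfin.subset sdiff_subset)).1 h2
  exact ⟨x, y, hxy, hx.1, hx.2, hy.1, hy.2⟩

/-- A triangle meeting the `4`-circuit `C` exactly in `p` has exactly two points outside `C`. -/
theorem ncard_sdiff_eq_two_of_inter (M : Matroid α) [M.Finite] {C T : Set α} (hT : M.IsCircuit T) (hT3 : T.ncard = 3)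
    {p : α} (hpT : p ∈ T) (hpC : p ∈ C) (hTC : T ∩ C ⊆ {p}) : (T \ C).ncard = 2 := by
  have hTfin : T.Finite := M.ground_finite.subset hT.subset_ground
  have h := Set.ncard_inter_add_ncard_sdiff_eq_ncard T C hTfin
  have hI : T ∩ C = {p} :=
    (Set.eq_of_subset_of_ncard_le (by simpa using (⟨hpT, hpC⟩ : p ∈ T ∩ C) : ({p} : Set α) ⊆ T ∩ C)
      (by rw [Set.ncard_singleton]; have := Set.ncard_le_ncard hTC (toFinite _); rwa [Set.ncard_singleton] at this)
      (hTfin.subset inter_subset_left)).symm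
  rw [hI, Set.ncard_singleton] at h
  omega

end S1

end PercRepro
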